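/-
Copyright: cell pub-balaban-gaps (YM BLITZ Y1, track G1), seat g1-p2 GEN 12 (unit `pub-balaban-gaps-g1-p2`).  Row (D4) NODE O,
MECHANISM level: the KERNEL of a block walk expansion inherits the block letters `‖K(σ,u)‖_{y,y′} ≤ K̄e^{−κd₁(y,y′)}` of its majorant
sum (entrywise `Σ_ω`, [B9] p. 416 «the expansion (3.107) is convergent in all norms in the inequalities (3.42)–(3.47)»), hence
`1 − K(σ,u)` is invertible when `K̄c_κ < 1` (Neumann, `D4WalkBlockLettersNeumann`) — the UNIT of (3.90) discharged from the margin; applied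
to 130: road (c′)'s END without the unit hypothesis.  HONEST FRAMING: [folklore] summation bookkeeping; nothing of Bałaban's `Δ^{(k)}(𝐔)`
is constructed; words of row (D4) UNCHANGED (`ExistsUniformAcrossSmall` + `TermDomination`, OBJECT level); (D4) instance 0∕1; NOT
BetaPertH, NOT continuum, NOT Clay.
-/
import Summits.QuantumFields.BalabanUV.Gaps.D4WalkBlockDecorate
import Summits.QuantumFields.BalabanUV.Gaps.D4WalkBlockLettersNeumann
import Summits.QuantumFields.BalabanUV.Gaps.D4WalkBlockTruncatedSeeds

/-!
# `Gaps.D4WalkBlockKernelLetters` — block letters of the kernel of a block walk expansion; the unit of (3.90) from the margin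
# (cell pub-balaban-gaps, seat g1-p2 gen 12)

HONEST DEPENDENCY (cell pub-balaban, verbatim): continuum YM on T⁴ ⇐ BetaPertH ∧ nine spine estimates (0/9 proved);
BetaPertH ⇐ (D1) ∧ (D4) ∧ CAP+tail.

* §1 `rowMass_kernel_le`, **`blockNorm_kernel_le`** (`‖K(σ,u)‖_{y,y′} ≤ K̄e^{−κd₁(y,y′)}` for a block walk expansion with `ε ≥ 0`),
  **`isUnit_one_sub_kernel`** (`K̄c_κ < 1` ⟹ `1 − K(σ,u)` invertible).
* §2 **`blockWalkExpansion_covOp_glued_unit`** — 130's `blockWalkExpansion_covOp_glued` with the unit `1 − R(u)` DISCHARGED by §1 from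
  the step expansion's constant: hypothesis `N r_g²θK̄·c_κ < 1` (a second reading of «M large») replaces `hunit`.
WHAT IT IS NOT.  Local invertibility of the `A′_□` (63's internal Neumann step; still a hypothesis); OBJECT level untouched.
References: T. Bałaban, Comm. Math. Phys. **99** (1985) [B9], (3.90) p. 409, (3.107)–(3.108) p. 416, p. 402.
-/

noncomputable section

namespace Summit.QuantumFields.BalabanUV.Gaps.D4WalkBlockKernelLetters

open Metric Set Finset
open scoped Matrix
open Literature.MathematicalPhysics.QuantumFieldTheory.Balaban1983to89
open Literature.MathematicalPhysics.QuantumFieldTheory.Balaban1983to89.B9SectDWalk (DomBy)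
open Literature.MathematicalPhysics.QuantumFieldTheory.Balaban1983to89.B9Thm34Ext (toB6)
open Literature.MathematicalPhysics.QuantumFieldTheory.Balaban1983to89.B9Thm37GlueTorus (torusGeom tdist1)
open Literature.MathematicalPhysics.QuantumFieldTheory.Balaban1983to89.TreeLengthTorus (TPt)
open Literature.MathematicalPhysics.QuantumFieldTheory.Balaban1983to89.B5TorusCover (UT)
open Literature.MathematicalPhysics.QuantumFieldTheory.Balaban1983to89.B11SectG (RowSum)
open Literature.MathematicalPhysics.QuantumFieldTheory.Balaban1983to89.B5Ineq137Torus (Nv blk)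
open Summit.QuantumFields.BalabanUV.Gaps.D4WalkBlock
  (rowMass blockNorm blockNorm_nonneg rowMass_le_blockNorm norm_entry_le_blockNorm blockNorm_le_of_rowMass_le BlockWalkExpansion)
open Summit.QuantumFields.BalabanUV.Gaps.D4WalkBlockDecorate (summable_of_partial_le)
open Summit.QuantumFields.BalabanUV.Gaps.D4WalkBlockLettersNeumann (isUnit_one_sub_of_blockLetters)
open Summit.QuantumFields.BalabanUV.Gaps.D4WalkBlockFlatLetters (cubeOf)
open Summit.QuantumFields.BalabanUV.Gaps.D4WalkBlockShiftAlgebra (fibD)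
open Summit.QuantumFields.BalabanUV.Gaps.D4WalkBlockShiftWeighted (wOp)
open Summit.QuantumFields.BalabanUV.Gaps.D4WalkBlockCovariantShift (covDop covB)
open Summit.QuantumFields.BalabanUV.Gaps.D4WalkBlockCovariantPropagator (covOp)
open Summit.QuantumFields.BalabanUV.Gaps.D4WalkBlockCovariantBlockAveraging (PU)
open Summit.QuantumFields.BalabanUV.Gaps.D4WalkBlockSeedTerms (PU_blockLocal)
open Summit.QuantumFields.BalabanUV.Gaps.D4WalkBlockTruncatedSeeds (covB_nonneg step_blockWalkExpansion blockWalkExpansion_covOp_glued)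

/-! ## §1. Block letters of the kernel; the unit -/

section Kernel
variable {ν : ℕ} {K : Fin ν → ℕ} [∀ i, NeZero (K i)]
variable {d N' : ℕ} {E : Type*} [NormedAddCommGroup E] [NormedSpace ℂ E]
variable {p n : Type} [Fintype p] [Fintype n]
variable {c₀ : B13.Consts} {cub : p → UT K} {cubn : n → UT K} {K2 : (TPt d N' → ℂ) → E → Matrix p n ℂ}
variable {X : Finset (UT K)} {R ε kap Kbar : ℝ}
variable {W : Type} {T2 : W → (TPt d N' → ℂ) → E → Matrix p n ℂ} {SX : Set W} {A : W → ℝ}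
variable {D : W → UT K → UT K → ℝ} {ρ : ℝ}

/-- **ROW MASSES OF THE KERNEL**: `Σ_{j ∈ y′}‖K(σ,u)_{ij}‖ ≤ K̄e^{−κd₁(cub i, y′)}` for a block walk expansion with `ε ≥ 0` (entrywise
`Σ_ω`, the majorants' partial sums bounded by `majSum`). [cite: Balaban1985BackgroundPropagators, (3.107)–(3.108) p.416] -/
theorem rowMass_kernel_le (h : BlockWalkExpansion c₀ cub cubn K2 X R ε kap Kbar T2 SX A D ρ) (hε : 0 ≤ ε)
    (σ : TPt d N' → ℂ) (hσ : ∀ j, ‖σ j‖ ≤ Real.exp c₀.κ₁) (u : E) (hu : u ∈ ball (0 : E) R) (i : p) (y' : UT K) :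
    rowMass cubn (K2 σ u) i y' ≤ Kbar * Real.exp (-(kap * tdist1 K (cub i) y')) := by
  classical
  set m : W → ℝ := fun ω => A ω * Real.exp (-((ρ - ε) * D ω (cub i) y')) with hm
  have hm0 : ∀ ω, 0 ≤ m ω := fun ω => mul_nonneg (h.A_nonneg ω) (Real.exp_nonneg _)
  have hmS : Summable m := summable_of_partial_le hm0 fun S => h.majSum S (cub i) y'
  have hexp : ∀ ω (z : UT K), Real.exp (-(ρ * D ω (cub i) z)) ≤ Real.exp (-((ρ - ε) * D ω (cub i) z)) := fun ω z =>
    Real.exp_le_exp.2 (by nlinarith [h.D_nonneg ω (cub i) z])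
  have hterm : ∀ ω, rowMass cubn (T2 ω σ u) i y' ≤ m ω := fun ω =>
    (rowMass_le_blockNorm cub cubn _ i y').trans ((h.majB ω σ hσ u hu _ _).trans
      (mul_le_mul_of_nonneg_left (hexp ω y') (h.A_nonneg ω)))
  have hnS : ∀ j, Summable (fun ω => ‖T2 ω σ u i j‖) := fun j => by
    refine Summable.of_nonneg_of_le (fun _ => norm_nonneg _) (fun ω => ?_)
      (summable_of_partial_le (fun ω => mul_nonneg (h.A_nonneg ω) (Real.exp_nonneg _)) fun S => h.majSum S (cub i) (cubn j))
    exact (norm_entry_le_blockNorm cub cubn (T2 ω σ u) i j).trans ((h.majB ω σ hσ u hu _ _).trans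
      (mul_le_mul_of_nonneg_left (hexp ω (cubn j)) (h.A_nonneg ω)))
  have hK : ∀ j, ‖K2 σ u i j‖ ≤ ∑' ω, ‖T2 ω σ u i j‖ := fun j => by
    rw [← (h.hasSum σ hσ u hu i j).tsum_eq]; exact norm_tsum_le_tsum_norm (hnS j)
  have hrowS : Summable (fun ω => rowMass cubn (T2 ω σ u) i y') :=
    Summable.of_nonneg_of_le (fun ω => D4WalkBlock.rowMass_nonneg cubn _ i y') hterm hmS
  unfold rowMass
  calc ∑ j ∈ Finset.univ.filter (fun j => cubn j = y'), ‖K2 σ u i j‖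
      ≤ ∑ j ∈ Finset.univ.filter (fun j => cubn j = y'), ∑' ω, ‖T2 ω σ u i j‖ := Finset.sum_le_sum fun j _ => hK j
    _ = ∑' ω, ∑ j ∈ Finset.univ.filter (fun j => cubn j = y'), ‖T2 ω σ u i j‖ :=
        (Summable.tsum_finsetSum fun j _ => hnS j).symm
    _ ≤ ∑' ω, m ω := Summable.tsum_le_tsum (fun ω => hterm ω) hrowS hmS
    _ ≤ Kbar * Real.exp (-(kap * tdist1 K (cub i) y')) := hmS.tsum_le_of_sum_le fun S => h.majSum S (cub i) y'

/-- **BLOCK LETTERS OF THE KERNEL**: `‖K(σ,u)‖_{y,y′} ≤ K̄e^{−κd₁(y,y′)}` (print p. 416: the expansion converges in all the norms of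
(3.42)–(3.47), so its sum has the bounds of the majorant). [cite: Balaban1985BackgroundPropagators, (3.107)–(3.108) p.416] -/
theorem blockNorm_kernel_le (h : BlockWalkExpansion c₀ cub cubn K2 X R ε kap Kbar T2 SX A D ρ) (hε : 0 ≤ ε)
    (σ : TPt d N' → ℂ) (hσ : ∀ j, ‖σ j‖ ≤ Real.exp c₀.κ₁) (u : E) (hu : u ∈ ball (0 : E) R) (y y' : UT K) :
    blockNorm cub cubn (K2 σ u) y y' ≤ Kbar * Real.exp (-(kap * tdist1 K y y')) := by
  have hK0 : 0 ≤ Kbar * Real.exp (-(kap * tdist1 K y y')) := by simpa using h.majSum ∅ y y'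
  refine blockNorm_le_of_rowMass_le cub cubn _ y y' hK0 fun i hi => ?_
  have := rowMass_kernel_le h hε σ hσ u hu i y'
  rwa [hi] at this

/-- **THE UNIT OF (3.90) FROM THE MARGIN**: a block walk expansion of `u ↦ K(σ,u)` on a square carrier with `ε ≥ 0`, cube row sum
`(κ, c_κ)` at the torus rate and `K̄c_κ < 1` ⟹ `1 − K(σ,u)` is invertible on the polydisc × ball (Neumann series in the
`ℓ^∞`-operator norm, `D4WalkBlockLettersNeumann`). [cite: Balaban1985BackgroundPropagators, (3.90) p.409, p.402] -/
theorem isUnit_one_sub_kernel [DecidableEq n] {K2 : (TPt d N' → ℂ) → E → Matrix n n ℂ} {T2 : W → (TPt d N' → ℂ) → E → Matrix n n ℂ}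
    (h : BlockWalkExpansion c₀ cubn cubn K2 X R ε kap Kbar T2 SX A D ρ) (hε : 0 ≤ ε) (hKbar : 0 ≤ Kbar) {cκ : ℝ} (hcκ : 0 ≤ cκ)
    (hrow : RowSum (toB6 (torusGeom K 0 0 0) 0 True) kap cκ) (hq : Kbar * cκ < 1)
    (σ : TPt d N' → ℂ) (hσ : ∀ j, ‖σ j‖ ≤ Real.exp c₀.κ₁) (u : E) (hu : u ∈ ball (0 : E) R) : IsUnit (1 - K2 σ u).det :=
  isUnit_one_sub_of_blockLetters cubn (K2 σ u) hKbar hcκ (blockNorm_kernel_le h hε σ hσ u hu) hrow hq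

end Kernel

/-! ## §2. Road (c′)'s END with the unit discharged -/

section End
variable {P : Params} {F : Type} [Fintype F] [DecidableEq F]
variable {dd N' : ℕ} {E : Type*} [NormedAddCommGroup E] [NormedSpace ℂ E]
variable {B : Type} [Fintype B] [DecidableEq B]
variable {c₀ : B13.Consts} {X : Finset (UT (Nv P P.K))} {R ε κ Kbar ρ δ₀ μr cμ : ℝ}
variable {W : B → Type} {T : (b : B) → W b → (TPt dd N' → ℂ) → E → Matrix (Site P 0 × F) (Site P 0 × F) ℂ}
variable {SX : (b : B) → Set (W b)} {A : (b : B) → W b → ℝ} {D : (b : B) → W b → UT (Nv P P.K) → UT (Nv P P.K) → ℝ}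
variable {pen : B → UT (Nv P P.K) → ℝ} {N rg : ℝ}
variable {Wp Wm : Fin P.d → E → Site P 0 → Matrix F F ℂ} {Ug Ugi : E → Site P 0 → Matrix F F ℂ}
variable {Wpl Wml : B → Fin P.d → E → Site P 0 → Matrix F F ℂ} {Ugl Ugil : B → E → Site P 0 → Matrix F F ℂ}
variable {a msq : ℝ} {g gi : B → Site P 0 → Matrix F F ℂ} {h : B → Site P 0 → ℝ} {S : B → Set (Site P 0)}
variable {δ₁ Λ β ω π θ : ℝ}

/-- **130's END WITH THE UNIT OF (3.90) DISCHARGED**: the hypothesis `IsUnit (1 − R(u))` of `blockWalkExpansion_covOp_glued` follows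
from §1 applied to the step expansion (`step_blockWalkExpansion`, constant `N r_g²θK̄` at the torus rate `κ`) once `ε ≥ 0` and
`N r_g²θK̄·c_κ < 1` for a cube row sum `(κ, c_κ)`. [cite: Balaban1985BackgroundPropagators, (3.87)–(3.90) p.409, p.402, (3.108) p.416; Balaban1988RG2Cluster, (1.11) p.5, p.15] -/
theorem blockWalkExpansion_covOp_glued_unit
    (hG : ∀ b, BlockWalkExpansion c₀ (fun q : Site P 0 × F => cubeOf P q.1) (fun q => cubeOf P q.1)
      (fun (_ : TPt dd N' → ℂ) u => (covOp P F (Wpl b) (Wml b) (PU P F (Ugl b) (Ugil b)) a msq u)⁻¹) X R ε κ Kbar (T b) (SX b)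
      (A b) (D b) ρ)
    (hGD : ∀ b ι ω (σ : TPt dd N' → ℂ), (∀ j, ‖σ j‖ ≤ Real.exp c₀.κ₁) → ∀ u ∈ ball (0 : E) R, ∀ y y',
      blockNorm (fun q : Site P 0 × F => cubeOf P q.1) (fun q => cubeOf P q.1) (covDop P F ι * T b ω σ u) y y' ≤
        covB P δ₀ ι * (A b ω * Real.exp (-(ρ * D b ω y y'))))
    (hGdom : ∀ b ω, DomBy (toB6 (torusGeom (Nv P P.K) 0 0 0) 0 True) (D b ω))
    (hερ : ε ≤ ρ) (hKbar : 0 ≤ Kbar) (hrg : 0 ≤ rg)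
    (hgr : ∀ b x a', ∑ b', ‖g b x a' b'‖ ≤ rg) (hgir : ∀ b x a', ∑ b', ‖gi b x a' b'‖ ≤ rg) (hh1 : ∀ b x, |h b x| ≤ 1)
    (hpen0 : ∀ b y, 0 ≤ pen b y) (hpenh : ∀ b x, pen b (cubeOf P x) ≠ 0 → h b x = 0)
    (hpenN : ∀ b x μ, pen b (cubeOf P x) ≠ 0 → h b (Site.shift x μ) = 0 ∧ h b (Site.unshift x μ) = 0)
    (hN : ∀ a, ∑ b, Real.exp (-((ρ - ε) * pen b a)) ≤ N)
    (hAhol : ∀ b p q, DifferentiableOn ℂ (fun u => covOp P F (Wpl b) (Wml b) (PU P F (Ugl b) (Ugil b)) a msq u p q) (ball (0 : E) R))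
    (hδ₁ : 0 ≤ δ₁) (hΛ : 0 ≤ Λ) (hβ : 0 ≤ β) (hω : 0 ≤ ω) (hπ : 0 ≤ π)
    (hdp : ∀ b μ y, |P.eps⁻¹ * (h b (Site.shift y μ) - h b y)| ≤ δ₁)
    (hdm : ∀ b μ y, |P.eps⁻¹ * (h b y - h b (Site.unshift y μ))| ≤ δ₁)
    (hlap : ∀ b μ y, |(P.eps⁻¹) ^ 2 * (h b (Site.shift y μ) - 2 * h b y + h b (Site.unshift y μ))| ≤ Λ)
    (hWpl : ∀ b μ, ∀ u ∈ ball (0 : E) R, ∀ x a', ∑ b', ‖Wpl b μ u x a' b'‖ ≤ P.eps * β)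
    (hWml : ∀ b μ, ∀ u ∈ ball (0 : E) R, ∀ x a', ∑ b', ‖Wml b μ u x a' b'‖ ≤ P.eps * β)
    (hosc : ∀ b x x', blk P P.K x = blk P P.K x' → |h b x - h b x'| ≤ ω)
    (hPUrow : ∀ b, ∀ u ∈ ball (0 : E) R, ∀ p, ∑ q, ‖PU P F (Ugl b) (Ugil b) u p q‖ ≤ π)
    (hθ : (∑ μ : Fin P.d, (1 + P.eps * β) * δ₁ * (covB P δ₀ (Sum.inl μ) + covB P δ₀ (Sum.inr μ))) +
      (P.d : ℝ) * (Λ + δ₁ * β + δ₁ * β) + |B1RG242Torus.α P a P.K| * (ω * π) ≤ θ)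
    -- the resummation (124): gauges, partition of unity, agreement of the local data with the gauged field, local invertibility
    (hg : ∀ b x, g b x * gi b x = 1) (hgi : ∀ b x, gi b x * g b x = 1) (hhS : ∀ b y, y ∉ S b → h b y = 0)
    (hsum : ∀ x, ∑ b, h b x ^ 2 = 1)
    (hp : ∀ u ∈ ball (0 : E) R, ∀ b μ y, y ∈ S b → Wpl b μ u (Site.unshift y μ) =
      g b (Site.unshift y μ) * (1 + Wp μ u (Site.unshift y μ)) * gi b (Site.shift (Site.unshift y μ) μ) - 1)
    (hm : ∀ u ∈ ball (0 : E) R, ∀ b μ y, y ∈ S b → Wml b μ u (Site.shift y μ) =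
      g b (Site.shift y μ) * (1 + Wm μ u (Site.shift y μ)) * gi b (Site.unshift (Site.shift y μ) μ) - 1)
    (hUgi : ∀ u ∈ ball (0 : E) R, ∀ b x y, y ∈ S b → blk P P.K x = blk P P.K y → Ugil b u x = g b x * Ugi u x)
    (hUg : ∀ u ∈ ball (0 : E) R, ∀ b y, y ∈ S b → Ugl b u y = Ug u y * gi b y)
    (hA' : ∀ b, ∀ u ∈ ball (0 : E) R, IsUnit (covOp P F (Wpl b) (Wml b) (PU P F (Ugl b) (Ugil b)) a msq u).det)
    -- the unit of (3.90) from the step expansion's constant (§1): `ε ≥ 0`, cube row sum `(κ, c_κ)`, `N r_g²θK̄·c_κ < 1`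
    (hε0 : 0 ≤ ε) {cκ : ℝ} (hcκ : 0 ≤ cκ) (hrowκ : RowSum (toB6 (torusGeom (Nv P P.K) 0 0 0) 0 True) κ cκ)
    (hqκ : N * (rg * rg * (θ * Kbar)) * cκ < 1)
    -- rates, cube row sum, margin (55)
    (hμ : 0 ≤ μr) (hμε : 2 * μr ≤ ε) (hμκ : 2 * μr ≤ κ) (hwin : κ + μr ≤ ρ - ε) (hcμ : 0 ≤ cμ)
    (hrow : RowSum (toB6 (torusGeom (Nv P P.K) 0 0 0) 0 True) μr cμ)
    (hq : cμ * (cμ * 1 * (1 * (N * (rg * rg * (θ * Kbar)))) * cμ) * cμ < 1) :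
    ∃ (W' : Type) (T' : W' → (TPt dd N' → ℂ) → E → Matrix (Site P 0 × F) (Site P 0 × F) ℂ) (SX' : Set W') (A' : W' → ℝ)
      (D' : W' → UT (Nv P P.K) → UT (Nv P P.K) → ℝ),
      BlockWalkExpansion c₀ (fun q : Site P 0 × F => cubeOf P q.1) (fun q => cubeOf P q.1)
        (fun (_ : TPt dd N' → ℂ) u => (covOp P F Wp Wm (PU P F Ug Ugi) a msq u)⁻¹) X R (ε - 2 * μr) (κ - 2 * μr)
        (cμ * (N * (rg * rg * Kbar)) * (1 * (1 - cμ * (cμ * 1 * (1 * (N * (rg * rg * (θ * Kbar)))) * cμ) * cμ)⁻¹) * cμ)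
        T' SX' A' D' (ρ - 2 * μr) ∧
      ∀ ω, DomBy (toB6 (torusGeom (Nv P P.K) 0 0 0) 0 True) (D' ω) := by
  have hθ0 : 0 ≤ θ := by
    have hc : ∀ ι, 0 ≤ covB P δ₀ ι := covB_nonneg δ₀
    have hηβ : 0 ≤ 1 + P.eps * β := by have := P.eps_pos; positivity
    refine le_trans (add_nonneg (add_nonneg (Finset.sum_nonneg fun μ _ => ?_) (by positivity)) (by positivity)) hθ
    exact mul_nonneg (mul_nonneg hηβ hδ₁) (add_nonneg (hc _) (hc _))
  have hN0 : 0 ≤ N := le_trans (Finset.sum_nonneg fun b _ => (Real.exp_pos _).le) (hN (cubeOf P default))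
  have hR := step_blockWalkExpansion (PUl := fun b => PU P F (Ugl b) (Ugil b)) hG hGD hερ hKbar hrg hgr hgir hh1 hpen0 hpenh hpenN hN
    hAhol hδ₁ hΛ hβ hω hπ hdp hdm hlap hWpl hWml (fun b u p q hne => PU_blockLocal P F (Ugl b) (Ugil b) u p q hne) hosc hPUrow hθ
  have hσ0 : ∀ j : TPt dd N', ‖(fun _ : TPt dd N' => (0 : ℂ)) j‖ ≤ Real.exp c₀.κ₁ := fun _ => by
    rw [norm_zero]; exact (Real.exp_pos _).le
  exact blockWalkExpansion_covOp_glued hG hGD hGdom hερ hKbar hrg hgr hgir hh1 hpen0 hpenh hpenN hN hAhol hδ₁ hΛ hβ hω hπ hdp hdm hlap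
    hWpl hWml hosc hPUrow hθ hg hgi hhS hsum hp hm hUgi hUg hA'
    (fun u hu => isUnit_one_sub_kernel hR hε0 (by positivity) hcκ hrowκ hqκ (fun _ => (0 : ℂ)) hσ0 u hu) hμ hμε hμκ hwin hcμ hrow hq

end End

end Summit.QuantumFields.BalabanUV.Gaps.D4WalkBlockKernelLetters

end
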